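import Summits.QuantumFields.BalabanUV.Beta.FP.SymmetryInheritGeneric
import Summits.QuantumFields.BalabanUV.Beta.FP.ShotBridgeMean

/-!
# `BalabanUV.Beta.FP.RoadEndShotMean` — road «FP» for binder row D1: THE COURIER's SIBLING of `FP/RoadEndShot` (asym1 g49's cut, filed verbatim) —
# (A) asym1 g49's remaining junction items J1∕J2∕J3m couriered, (B) road FP's three generic ENDs and the scalar value with `hasym` SUPPLIED BY THE
# BRIDGE AT ROAD BF-x's MEAN GRADING (`FP/ShotBridgeMean.hasym_of_cesaro_twoStage`, p227663): `hTlaw` WEAKENED to `F₀(Lc^k)/k → stepBal N Lc`, `Cg := D`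
# (β sub-cell; courier ∕ author of (B): `b2b-balaban-gan24-formalise-leaf-02` gen 33, idle G-an2-4 swarm leaf seat, cross-lane; claim table
# `HOME/b2b-balaban-beta-d1-p3/LEAVES-FP.md` row BRIDGE-INSTANCE (re-scoped by the road owner, journal 2026-08-20 ≈16:56Z (f)); author's answer
# (α)∕(β) 17:03Z — this is (α) with the addendum moved to a sibling to keep both files ≤ 400 lines and the author's bytes untouched; imports `FP.SymmetryInheritGeneric` + `FP.ShotBridgeMean` only — `FP.RoadEndShot` itself is not needed)

NOT IN PRINT; OUR BOOKKEEPING.  HONEST FRAMING (cell charter, verbatim): «discharging `BetaPertH` makes Bałaban's UV stability UNCONDITIONAL — a real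
constructive-QFT result; it is NOT the continuum limit and NOT the Clay problem.»  THIS MODULE DISCHARGES NOTHING: it COMPOSES tree theorems BY NAME.
Every analytic input — road BF-x's level-0 law (here in its MEAN ∕ Cesàro grading, the `hT` shape of `D1BFx/RoadEnd.d1Drift_of_meanRoad`), the one-stage ∕
two-stage telescoping identities and their defect bounds, X1 (Cauchy currency) ∕ X1m, the Cauchy-currency rows, `hWf`∕`hWj`, `hTsymm`∕`hTj`, `hSDF`, (STEP) —
is a HYPOTHESIS with free constants, displayed, none discharged.  0 `def`, 0 cite, 0 sorry.  NOT «D1 closed», NEVER «G-an2-4 closed», NOT (ASYMP) proved,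
NOT BetaPertH, NOT continuum, NOT Clay.
CONTENT.
* §A (asym1 g49's probe `HOME/b2b-balaban-beta-asym1-g49/XreadShotBridge.lean` bb63e4ce29b77f10 §X1∕§X2∕§X4m, couriered verbatim up to namespace):
  `geomRate_iff_shot_rate` (the bridge's rate binder IS `RateCertificate.GeomRate`, `Iff.rfl`), `shot_bounded_of_geomRate` (`ShotBridge.shot_bounded_of_value_rate`
  fed by a `GeomRate` BY NAME, `0 ≤ c` discharged by `GeomRate.const_nonneg`), `lim_eq_of_shotMean_cauchyRate` ∕ `geomRate_of_shotMean_cauchyRate` (T_mean +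
  Cesàro-null one-stage defect + X1-Cauchy ⟹ `CauchyRate.lim β = s` and the geometric clause — the MEAN-grade twin of `RoadEndShot.lim_eq_of_shot_cauchyRate`).
* §B (this seat): `value_eq_of_shotMean_twoStage_step_law` (scalar: T_mean + two-stage defects `≤ D` + X1m + step law ⟹ `g 1 = s`) and the three END twins
  **`d1Drift_of_generic_step_law_shotMean`**, **`d1Drift_of_generic_ward_symm_explicitDefect_shotMean`**, **`d1Drift_of_generic_wardRow_swapRow_shotMean`** —
  binder lists = `RoadEndShot` §2's with `hTlaw`∕`C₀` replaced by `hTmean : Tendsto (fun k => F₀ (Lc^k) / k) atTop (𝓝 (stepBal N Lc))`, nothing else; each is the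
  tree END of record (`RoadEndGeneric` p224132 ∕ `StepLawWardGeneric` p224345 ∕ `SymmetryInheritGeneric` p226775) applied to
  `hasym_of_cesaro_twoStage hTmean htel2 hδ2 hlimX1m`.  READING: with R-FP-14's bridge, road BF-x's MEAN grading already reaches road FP's ENDs, and the
  two-stage defect bound `D` is the only (ASYMP) constant that survives.
ABSOLUTE RULE (cell charter, verbatim): «No internally-minted statement may enter as a cited fact. Every hypothesis is either kernel-proved in this
package or a verbatim quotation of a PUBLISHED theorem with page reference.»  Nothing cited; no binder instantiated at a value.
HONEST DEPENDENCY (verbatim): «continuum YM on T⁴ ⇐ BetaPertH ∧ nine spine estimates (0/9 proved); BetaPertH ⇐ (D1) ∧ (D4) ∧ CAP+tail;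
G-an2-4 gates asym, D1 and NE2/3/4.»
Provenance: §A author lane beta-asym1 (planner seat, gen 49); courier and §B b2b-balaban-gan24-formalise-leaf-02 gen 33, 2026-08-20; no existing file touched.
-/

noncomputable section

namespace Summit.QuantumFields.BalabanUV.Beta.FP.RoadEndShotMean

open Filter Topology
open Literature.MathematicalPhysics.QuantumFieldTheory.Balaban1983to89
open Literature.MathematicalPhysics.QuantumFieldTheory.Balaban1983to89.Beta
open Literature.MathematicalPhysics.QuantumFieldTheory.Balaban1983to89.Beta.RateCertificate (GeomRate CauchyRate)
open Literature.MathematicalPhysics.QuantumFieldTheory.Balaban1983to89.Beta.Drift (OneLoopDrift)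
open B12Beta (secondMoment)
open B12Normalization (stepBal)
open DressedMomentNormalisation (EKer dressedEntry)
open ExpKernelCalculus (MKer Decays VertexFamily₂ hessKer)
open PolarizationSign (WardTransversal)
open OneStepResolventKernel (Fib LocStencil JetData)
open OneStepKernelFamily (vertexOfK TbalOf flipK D1Drift)
open Summit.QuantumFields.BalabanUV.Beta.HessKerDressedUnits (unitK unitS unitW)
open Summit.QuantumFields.BalabanUV.Beta.GAN24.CombesThomas (sfStep smStep)
open Summit.QuantumFields.BalabanUV.Beta.FP.PerfectObjectsT (KPerf SPerfOf WPerfOf)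
open Summit.QuantumFields.BalabanUV.Beta.FP.TransportInfinityM (colOf)
open Summit.QuantumFields.BalabanUV.Beta.FP.StepDefectInherit (defect)
open Summit.QuantumFields.BalabanUV.Beta.FP.RoadEnd (value_eq_of_step_law_bounded')
open Summit.QuantumFields.BalabanUV.Beta.FP.RoadEndGeneric (KPerfOf TGenOf fPerfG d1Drift_of_generic_step_law_bounded)
open Summit.QuantumFields.BalabanUV.Beta.FP.StepLawWardGeneric (d1Drift_of_generic_ward_symm_explicitDefect)
open Summit.QuantumFields.BalabanUV.Beta.FP.SymmetryInheritGeneric (d1Drift_of_generic_wardRow_swapRow_explicitDefect)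
open Summit.QuantumFields.BalabanUV.Beta.FP.ShotBridgeMean (hasym_of_cesaro_twoStage)


/-! ## §A (asym1 g49, couriered) the bridge's rate currency IS `GeomRate`; the MEAN-grade identification of the limit -/

/-- [folklore] `GeomRate β s c θ` and `ShotBridge.shot_bounded_of_value_rate`'s `hβ` are ONE PROP (definitional). (asym1 g49 §X1) -/
theorem geomRate_iff_shot_rate {β : ℕ → ℝ} {s c θ : ℝ} :
    GeomRate β s c θ ↔ ∀ j : ℕ, |β j - s| ≤ c * θ ^ j := Iff.rfl

/-- [folklore] BF-x's level-0 law from a `GeomRate` (road FP's value + X1 rate in the certificate's currency) + one-stage telescoping; `0 ≤ c`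
discharged by `GeomRate.const_nonneg`. (asym1 g49 §X2) -/
theorem shot_bounded_of_geomRate {F₀ β ε : ℕ → ℝ} {s c θ E : ℝ} {L : ℕ}
    (h : GeomRate β s c θ) (hθ0 : 0 ≤ θ) (hθ1 : θ < 1)
    (htel : ∀ k : ℕ, F₀ (L ^ k) = ∑ j ∈ Finset.range k, β j + ε k) (hε : ∀ k : ℕ, |ε k| ≤ E) (k : ℕ) :
    |F₀ (L ^ k) - (k : ℝ) * s| ≤ c / (1 - θ) + E :=
  ShotBridge.shot_bounded_of_value_rate h h.const_nonneg hθ0 hθ1 htel hε k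

/-- [folklore] MEAN grade: BF-x's level-0 law in Cesàro form `F₀(L^k)/k → s` + one-stage telescoping with a Cesàro-null cumulative defect
`ε k / k → 0` + X1 in Cauchy currency ⟹ `CauchyRate.lim β = s` (Mathlib `Filter.Tendsto.cesaro`; uniqueness of limits). (asym1 g49 §X4m) -/
theorem lim_eq_of_shotMean_cauchyRate {F₀ β ε : ℕ → ℝ} {s c θ : ℝ} {L : ℕ}
    (hTm : Tendsto (fun k : ℕ => F₀ (L ^ k) / (k : ℝ)) atTop (𝓝 s))
    (htel : ∀ k : ℕ, F₀ (L ^ k) = ∑ j ∈ Finset.range k, β j + ε k)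
    (hεm : Tendsto (fun k : ℕ => ε k / (k : ℝ)) atTop (𝓝 0))
    (hX1 : CauchyRate β c θ) (hθ1 : θ < 1) : CauchyRate.lim β = s := by
  have hces : Tendsto (fun k : ℕ => (∑ j ∈ Finset.range k, β j) / (k : ℝ)) atTop (𝓝 (CauchyRate.lim β)) := by
    refine (hX1.tendsto_lim hθ1).cesaro.congr' (Eventually.of_forall fun k => ?_)
    simp [div_eq_inv_mul]
  have h2 : Tendsto (fun k : ℕ => (∑ j ∈ Finset.range k, β j) / (k : ℝ)) atTop (𝓝 (s - 0)) := by
    refine (hTm.sub hεm).congr' (Eventually.of_forall fun k => ?_)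
    show F₀ (L ^ k) / (k : ℝ) - ε k / (k : ℝ) = (∑ j ∈ Finset.range k, β j) / (k : ℝ)
    rw [htel k]; ring
  rw [sub_zero] at h2
  exact tendsto_nhds_unique hces h2

/-- [folklore] … hence again `GeomRate β s (c/(1−θ)) θ`: for the geometric clause with identified limit, BF-x's MEAN grade + X1-Cauchy suffice.
(asym1 g49 §X4m) -/
theorem geomRate_of_shotMean_cauchyRate {F₀ β ε : ℕ → ℝ} {s c θ : ℝ} {L : ℕ}
    (hTm : Tendsto (fun k : ℕ => F₀ (L ^ k) / (k : ℝ)) atTop (𝓝 s))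
    (htel : ∀ k : ℕ, F₀ (L ^ k) = ∑ j ∈ Finset.range k, β j + ε k)
    (hεm : Tendsto (fun k : ℕ => ε k / (k : ℝ)) atTop (𝓝 0))
    (hX1 : CauchyRate β c θ) (hθ1 : θ < 1) : GeomRate β s (c / (1 - θ)) θ := by
  have h := hX1.geomRate hθ1
  rwa [lim_eq_of_shotMean_cauchyRate hTm htel hεm hX1 hθ1] at h

/-! ## §B (this seat) the MEAN-LAW TWINS: road BF-x's MEAN grading supplies `hasym`, with `Cg := D` -/

/-- [our object] SCALAR LEVEL, MEAN grading: T_mean `F₀(L^k)/k → s` + two-stage defects bounded by `D` + X1m + the step law `g (m+1) = g m + g 1`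
⟹ the EXACT value `g 1 = s` (`RoadEnd.value_eq_of_step_law_bounded'` with `hasym := hasym_of_cesaro_twoStage …`, `C := D`). -/
theorem value_eq_of_shotMean_twoStage_step_law {F₀ : ℕ → ℝ} {f δ : ℕ → ℕ → ℝ} {g : ℕ → ℝ} {s D : ℝ} {L : ℕ}
    (hTm : Tendsto (fun k : ℕ => F₀ (L ^ k) / (k : ℝ)) atTop (𝓝 s))
    (htel : ∀ j m : ℕ, F₀ (L ^ (j + m)) = F₀ (L ^ j) + f j m + δ j m)
    (hδ : ∀ j m : ℕ, |δ j m| ≤ D) (hlim : ∀ m : ℕ, Tendsto (fun j => f j m) atTop (𝓝 (g m)))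
    (hstep : ∀ m : ℕ, 1 ≤ m → g (m + 1) = g m + g 1) : g 1 = s :=
  value_eq_of_step_law_bounded' hstep (hasym_of_cesaro_twoStage hTm htel hδ hlim)

section EndMean

variable {Lc : ℕ} [NeZero Lc] (Js : ℕ → JetData 3 Lc) (sf sm : ℕ → ℝ) (A G : ℕ → ℕ → MKer (3 + 1) (Fib 3))
  (S : ℕ → ℕ → Fin (3 + 1) → (Fin (3 + 1) → ℤ) → MKer (3 + 1) (Fib 3))
  (Wt : ℕ → ℕ → Fin (3 + 1) → (Fin (3 + 1) → ℤ) → Fin (3 + 1) → (Fin (3 + 1) → ℤ) → MKer (3 + 1) (Fib 3))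
  {A1 G1 : ℕ → MKer (3 + 1) (Fib 3)} {S1 : ℕ → Fin (3 + 1) → (Fin (3 + 1) → ℤ) → MKer (3 + 1) (Fib 3)}
  {W1 : ℕ → Fin (3 + 1) → (Fin (3 + 1) → ℤ) → Fin (3 + 1) → (Fin (3 + 1) → ℤ) → MKer (3 + 1) (Fib 3)}
  {R CA cA C cK δK Cs cS δS Cw cW δW θ : ℝ}
/-- **ROAD «FP», THE GENERIC END WITH (ASYMP) := THE BRIDGE AT ROAD BF-x's MEAN GRADING** (`d = 3`; bounded two-stage defect, MEAN level-0 law).  `RoadEndGeneric.d1Drift_of_generic_step_law_bounded`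
with its `hasym` argument `ShotBridgeMean.hasym_of_cesaro_twoStage hTmean htel2 hδ2 hlimX1m` (`Cg := D` by unification).  RESIDUAL: {closed form + `m = 1`
names; Cauchy-currency rows (`m = 1`); (STEP) `hstep`; BF-x's MEAN level-0 law `hTmean : F₀(Lc^k)/k → stepBal N Lc` (the `hT` shape of `D1BFx/RoadEnd.d1Drift_of_meanRoad`); two-stage telescoping `htel2` with `|δ j m| ≤ D`;
X1m `hlimX1m`} ⊢ `D1Drift Lc Js N μ ν`.  NOT «D1 closed». [our object] (the tree END is the owner's ∕ leaf-01's; the bounded-law twin in `FP/RoadEndShot` is asym1 g49's) -/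
theorem d1Drift_of_generic_step_law_shotMean (hsf : ∀ j, sf j ≠ 0) (hsm : ∀ j, sm j ≠ 0)
    (hT : ∀ j, TbalOf Lc Js j = hessKer (A1 j) (vertexOfK (G1 j) Lc (S1 j)) (W1 j))
    (hA1 : ∀ j, A j 1 = A1 j) (hG1 : ∀ j, G j 1 = G1 j) (hS1 : ∀ j, S j 1 = S1 j) (hW1 : ∀ j, Wt j 1 = W1 j)
    (hA : ∀ j, Decays (unitK (sf j) (sm j) (A1 j)) CA δK)
    (hAall : ∀ k j, Decays (unitK (sf (k + j)) (sm (k + j)) (A1 (k + j)) - unitK (sf k) (sm k) (A1 k)) (cA * θ ^ k) δK)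
    (hK : ∀ j, Decays (unitK (sf j) (sm j) (G1 j)) C δK)
    (hKall : ∀ k j, Decays (unitK (sf (k + j)) (sm (k + j)) (G1 (k + j)) - unitK (sf k) (sm k) (G1 k)) (cK * θ ^ k) δK)
    (hS : ∀ j, LocStencil (unitS (sf j) (sm j) (S1 j)) Cs δS)
    (hSall : ∀ k j, LocStencil (unitS (sf (k + j)) (sm (k + j)) (S1 (k + j)) - unitS (sf k) (sm k) (S1 k)) (cS * θ ^ k) δS)
    (hW : ∀ j, VertexFamily₂ (unitW (sf j) (sm j) (W1 j)) Lc Cw δW)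
    (hWall : ∀ k j, VertexFamily₂ (unitW (sf (k + j)) (sm (k + j)) (W1 (k + j)) - unitW (sf k) (sm k) (W1 k)) Lc (cW * θ ^ k) δW)
    (hR : 0 < R) (hRK : R < δK) (hRS : R / 2 < δS) (hRW : R < δW) (hθ0 : 0 ≤ θ) (hθ1 : θ < 1) (μ ν : Fin 4) {N : ℝ}
    (hstep : ∀ m : ℕ, 1 ≤ m →
      fPerfG Lc sf sm A G S Wt μ ν (m + 1) = fPerfG Lc sf sm A G S Wt μ ν m + fPerfG Lc sf sm A G S Wt μ ν 1)
    {F₀ : ℕ → ℝ} {f δ : ℕ → ℕ → ℝ} {D : ℝ}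
    (hTmean : Tendsto (fun k : ℕ => F₀ (Lc ^ k) / (k : ℝ)) atTop (𝓝 (stepBal N Lc)))
    (htel2 : ∀ j m : ℕ, F₀ (Lc ^ (j + m)) = F₀ (Lc ^ j) + f j m + δ j m)
    (hδ2 : ∀ j m : ℕ, |δ j m| ≤ D)
    (hlimX1m : ∀ m : ℕ, Tendsto (fun j => f j m) atTop (𝓝 (fPerfG Lc sf sm A G S Wt μ ν m))) :
    D1Drift Lc Js N μ ν :=
  d1Drift_of_generic_step_law_bounded Js sf sm A G S Wt hsf hsm hT hA1 hG1 hS1 hW1 hA hAall hK hKall hS hSall hW hWall hR hRK hRS hRW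
    hθ0 hθ1 μ ν hstep (hasym_of_cesaro_twoStage hTmean htel2 hδ2 hlimX1m)

/-- **ROAD «FP», THE WARD END WITH (ASYMP) := THE BRIDGE AT ROAD BF-x's MEAN GRADING** (`d = 3`, `2 ≤ Lc`; bounded two-stage defect, MEAN level-0 law).  `StepLawWardGeneric.d1Drift_of_generic_ward_symm_explicitDefect`
with `hasym := ShotBridgeMean.hasym_of_cesaro_twoStage hTmean htel2 hδ2 hlimX1m` (`Cg := D`).  RESIDUAL: {closed form + `m = 1` names; Cauchy rows (`m = 1`); class data (`m ≥ 1`); **hWf**;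
**hTsymm**; **hSDF**; `hTmean` (MEAN law); `htel2` + `hδ2`; `hlimX1m`} ⊢ `D1Drift Lc Js N μ ν`.  NOT «D1 closed». [our object] (the tree END is the owner's ∕ leaf-01's; the bounded-law twin in `FP/RoadEndShot` is asym1 g49's) -/
theorem d1Drift_of_generic_ward_symm_explicitDefect_shotMean (hLc2 : 2 ≤ Lc) (hsf : ∀ j, sf j ≠ 0) (hsm : ∀ j, sm j ≠ 0)
    (hT : ∀ j, TbalOf Lc Js j = hessKer (A1 j) (vertexOfK (G1 j) Lc (S1 j)) (W1 j))
    (hA1 : ∀ j, A j 1 = A1 j) (hG1 : ∀ j, G j 1 = G1 j) (hS1 : ∀ j, S j 1 = S1 j) (hW1 : ∀ j, Wt j 1 = W1 j)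
    (hA : ∀ j, Decays (unitK (sf j) (sm j) (A1 j)) CA δK)
    (hAall : ∀ k j, Decays (unitK (sf (k + j)) (sm (k + j)) (A1 (k + j)) - unitK (sf k) (sm k) (A1 k)) (cA * θ ^ k) δK)
    (hK : ∀ j, Decays (unitK (sf j) (sm j) (G1 j)) C δK)
    (hKall : ∀ k j, Decays (unitK (sf (k + j)) (sm (k + j)) (G1 (k + j)) - unitK (sf k) (sm k) (G1 k)) (cK * θ ^ k) δK)
    (hS : ∀ j, LocStencil (unitS (sf j) (sm j) (S1 j)) Cs δS)
    (hSall : ∀ k j, LocStencil (unitS (sf (k + j)) (sm (k + j)) (S1 (k + j)) - unitS (sf k) (sm k) (S1 k)) (cS * θ ^ k) δS)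
    (hW : ∀ j, VertexFamily₂ (unitW (sf j) (sm j) (W1 j)) Lc Cw δW)
    (hWall : ∀ k j, VertexFamily₂ (unitW (sf (k + j)) (sm (k + j)) (W1 (k + j)) - unitW (sf k) (sm k) (W1 k)) Lc (cW * θ ^ k) δW)
    (hR : 0 < R) (hRK : R < δK) (hRS : R / 2 < δS) (hRW : R < δW) (hθ0 : 0 ≤ θ) (hθ1 : θ < 1)
    (hAinf : ∀ m : ℕ, 1 ≤ m → ∃ δ C : ℝ, 0 < δ ∧ 0 ≤ C ∧ Decays (KPerfOf (d := 3) sf sm A m) C δ)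
    (hGinf : ∀ m : ℕ, 1 ≤ m → ∃ δ C : ℝ, 0 < δ ∧ 0 ≤ C ∧ Decays (KPerfOf (d := 3) sf sm G m) C δ)
    (hSinf : ∀ m : ℕ, 1 ≤ m → ∃ Cs δS : ℝ, 0 < δS ∧ LocStencil (SPerfOf sf sm S m) Cs δS)
    (hWinf : ∀ m : ℕ, 1 ≤ m → ∃ Cw δW : ℝ, 0 < δW ∧ VertexFamily₂ (WPerfOf sf sm Wt m) (Lc ^ m) Cw δW)
    (hWf : WardTransversal (flipK (TGenOf Lc (KPerfOf sf sm A 1) (KPerfOf sf sm G 1) (SPerfOf sf sm S 1) (WPerfOf sf sm Wt 1))))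
    (hTsymm : ∀ a b t, TGenOf Lc (KPerfOf sf sm A 1) (KPerfOf sf sm G 1) (SPerfOf sf sm S 1) (WPerfOf sf sm Wt 1) a b t
      = TGenOf Lc (KPerfOf sf sm A 1) (KPerfOf sf sm G 1) (SPerfOf sf sm S 1) (WPerfOf sf sm Wt 1) b a (-t))
    (μ ν : Fin 4)
    (hSDF : ∀ m : ℕ, 1 ≤ m → secondMoment (defect
      (fun m => TGenOf (Lc ^ m) (KPerfOf sf sm A m) (KPerfOf sf sm G m) (SPerfOf sf sm S m) (WPerfOf sf sm Wt m))
      (fun m a b z => ((Lc ^ m : ℕ) : ℝ) ^ 8 * dressedEntry (colOf (KPerf (d := 3) Lc (sfStep Lc) (smStep 3 Lc) m))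
        (TGenOf Lc (KPerfOf sf sm A 1) (KPerfOf sf sm G 1) (SPerfOf sf sm S 1) (WPerfOf sf sm Wt 1))
        (((Lc ^ m : ℕ) : ℤ) • z) a b) m) μ ν = 0)
    {N : ℝ} {F₀ : ℕ → ℝ} {f δ : ℕ → ℕ → ℝ} {D : ℝ}
    (hTmean : Tendsto (fun k : ℕ => F₀ (Lc ^ k) / (k : ℝ)) atTop (𝓝 (stepBal N Lc)))
    (htel2 : ∀ j m : ℕ, F₀ (Lc ^ (j + m)) = F₀ (Lc ^ j) + f j m + δ j m)
    (hδ2 : ∀ j m : ℕ, |δ j m| ≤ D)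
    (hlimX1m : ∀ m : ℕ, Tendsto (fun j => f j m) atTop (𝓝 (fPerfG Lc sf sm A G S Wt μ ν m))) :
    D1Drift Lc Js N μ ν :=
  d1Drift_of_generic_ward_symm_explicitDefect Js sf sm A G S Wt hLc2 hsf hsm hT hA1 hG1 hS1 hW1 hA hAall hK hKall hS hSall hW hWall hR hRK
    hRS hRW hθ0 hθ1 hAinf hGinf hSinf hWinf hWf hTsymm μ ν hSDF (hasym_of_cesaro_twoStage hTmean htel2 hδ2 hlimX1m)

/-- **ROAD «FP», THE END FROM THE WALL's SYMMETRY ROWS WITH (ASYMP) := THE BRIDGE AT ROAD BF-x's MEAN GRADING** (`d = 3`, `2 ≤ Lc`; bounded two-stage defect, MEAN level-0 law).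
`SymmetryInheritGeneric.d1Drift_of_generic_wardRow_swapRow_explicitDefect` with `hasym := ShotBridgeMean.hasym_of_cesaro_twoStage hTmean htel2 hδ2 hlimX1m` (`Cg := D`).  RESIDUAL:
{closed form + `m = 1` names; Cauchy rows (`m = 1`); class data (`m ≥ 1`); **hWj**; **hTj**; **hSDF**; `hTmean` (MEAN law); `htel2` + `hδ2`; `hlimX1m`} ⊢ `D1Drift Lc Js N μ ν`.
NOT «D1 closed». [our object] (the tree END is the owner's ∕ leaf-01's; the bounded-law twin in `FP/RoadEndShot` is asym1 g49's) -/
theorem d1Drift_of_generic_wardRow_swapRow_shotMean (hLc2 : 2 ≤ Lc) (hsf : ∀ j, sf j ≠ 0) (hsm : ∀ j, sm j ≠ 0)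
    (hT : ∀ j, TbalOf Lc Js j = hessKer (A1 j) (vertexOfK (G1 j) Lc (S1 j)) (W1 j))
    (hA1 : ∀ j, A j 1 = A1 j) (hG1 : ∀ j, G j 1 = G1 j) (hS1 : ∀ j, S j 1 = S1 j) (hW1 : ∀ j, Wt j 1 = W1 j)
    (hA : ∀ j, Decays (unitK (sf j) (sm j) (A1 j)) CA δK)
    (hAall : ∀ k j, Decays (unitK (sf (k + j)) (sm (k + j)) (A1 (k + j)) - unitK (sf k) (sm k) (A1 k)) (cA * θ ^ k) δK)
    (hK : ∀ j, Decays (unitK (sf j) (sm j) (G1 j)) C δK)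
    (hKall : ∀ k j, Decays (unitK (sf (k + j)) (sm (k + j)) (G1 (k + j)) - unitK (sf k) (sm k) (G1 k)) (cK * θ ^ k) δK)
    (hS : ∀ j, LocStencil (unitS (sf j) (sm j) (S1 j)) Cs δS)
    (hSall : ∀ k j, LocStencil (unitS (sf (k + j)) (sm (k + j)) (S1 (k + j)) - unitS (sf k) (sm k) (S1 k)) (cS * θ ^ k) δS)
    (hW : ∀ j, VertexFamily₂ (unitW (sf j) (sm j) (W1 j)) Lc Cw δW)
    (hWall : ∀ k j, VertexFamily₂ (unitW (sf (k + j)) (sm (k + j)) (W1 (k + j)) - unitW (sf k) (sm k) (W1 k)) Lc (cW * θ ^ k) δW)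
    (hR : 0 < R) (hRK : R < δK) (hRS : R / 2 < δS) (hRW : R < δW) (hθ0 : 0 ≤ θ) (hθ1 : θ < 1)
    (hAinf : ∀ m : ℕ, 1 ≤ m → ∃ δ C : ℝ, 0 < δ ∧ 0 ≤ C ∧ Decays (KPerfOf (d := 3) sf sm A m) C δ)
    (hGinf : ∀ m : ℕ, 1 ≤ m → ∃ δ C : ℝ, 0 < δ ∧ 0 ≤ C ∧ Decays (KPerfOf (d := 3) sf sm G m) C δ)
    (hSinf : ∀ m : ℕ, 1 ≤ m → ∃ Cs δS : ℝ, 0 < δS ∧ LocStencil (SPerfOf sf sm S m) Cs δS)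
    (hWinf : ∀ m : ℕ, 1 ≤ m → ∃ Cw δW : ℝ, 0 < δW ∧ VertexFamily₂ (WPerfOf sf sm Wt m) (Lc ^ m) Cw δW)
    (hWj : ∀ j, WardTransversal (flipK (TbalOf Lc Js j)))
    (hTj : ∀ j a b t, TbalOf Lc Js j a b t = TbalOf Lc Js j b a (-t))
    (μ ν : Fin 4)
    (hSDF : ∀ m : ℕ, 1 ≤ m → secondMoment (defect
      (fun m => TGenOf (Lc ^ m) (KPerfOf sf sm A m) (KPerfOf sf sm G m) (SPerfOf sf sm S m) (WPerfOf sf sm Wt m))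
      (fun m a b z => ((Lc ^ m : ℕ) : ℝ) ^ 8 * dressedEntry (colOf (KPerf (d := 3) Lc (sfStep Lc) (smStep 3 Lc) m))
        (TGenOf Lc (KPerfOf sf sm A 1) (KPerfOf sf sm G 1) (SPerfOf sf sm S 1) (WPerfOf sf sm Wt 1))
        (((Lc ^ m : ℕ) : ℤ) • z) a b) m) μ ν = 0)
    {N : ℝ} {F₀ : ℕ → ℝ} {f δ : ℕ → ℕ → ℝ} {D : ℝ}
    (hTmean : Tendsto (fun k : ℕ => F₀ (Lc ^ k) / (k : ℝ)) atTop (𝓝 (stepBal N Lc)))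
    (htel2 : ∀ j m : ℕ, F₀ (Lc ^ (j + m)) = F₀ (Lc ^ j) + f j m + δ j m)
    (hδ2 : ∀ j m : ℕ, |δ j m| ≤ D)
    (hlimX1m : ∀ m : ℕ, Tendsto (fun j => f j m) atTop (𝓝 (fPerfG Lc sf sm A G S Wt μ ν m))) :
    D1Drift Lc Js N μ ν :=
  d1Drift_of_generic_wardRow_swapRow_explicitDefect Js sf sm A G S Wt hLc2 hsf hsm hT hA1 hG1 hS1 hW1 hA hAall hK hKall hS hSall hW hWall
    hR hRK hRS hRW hθ0 hθ1 hAinf hGinf hSinf hWinf hWj hTj μ ν hSDF (hasym_of_cesaro_twoStage hTmean htel2 hδ2 hlimX1m)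


end EndMean

end Summit.QuantumFields.BalabanUV.Beta.FP.RoadEndShotMean

end
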